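import Mathlib.Analysis.ODE.ExistUnique
import Mathlib.Analysis.Calculus.MeanValue
import Literature.Analysis.FunctionSpaces.ContDiffHolderLeibniz
import Literature.Analysis.FunctionSpaces.TorusCalculusProofs
import Literature.Analysis.FunctionSpaces.TorusSpaceTime
import Literature.Analysis.FunctionSpaces.TorusHolderBridge
import HarnessLib

/-!
# Hölder estimates for smooth solutions of transport equations on the flat torus

Buckmaster–De Lellis–Székelyhidi–Vicol, *Onsager's conjecture for admissible weak solutions*,
CPAM 72 (2019) = arXiv:1701.08678, App. B "Estimates for transport equations", Prop. B.1,
(B.1)–(B.2): for a smooth solution of `∂ₜf + v·∇f = g`, `f(·,t₀) = f₀`,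
`‖f(t)‖₀ ≤ ‖f₀‖₀ + ∫ ‖g‖₀` and, when `|t - t₀| ‖v‖₁ ≤ 1`,
`‖f(t)‖_α ≤ 2(‖f₀‖_α + ∫ ‖g‖_α)` ("standard estimates … for a detailed proof the reader might
consult [BDLISz2015]"). This file **proves** these estimates for jointly smooth fields on
`[a,b] × T^d` with values in a real normed space, in the sharp form produced by the method of
characteristics,

  `‖f(t)‖_∞ ≤ ‖f(t₀)‖_∞ + |t - t₀| sup_s ‖g(s)‖_∞`,
  `[f(t)]_α ≤ e^{αK|t-t₀|} ([f(t₀)]_α + |t - t₀| sup_s [g(s)]_α)`   (`‖Dv‖ ≤ K`),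

the sups being over `s` between `t₀` and `t` (`Torus.eSupNorm_transport_le`,
`Torus.eHolderNorm_transport_le`, and the `C^{0,α}` form `Torus.eContDiffHolderNorm_transport_le`
in the accepted norm `Torus.eContDiffHolderNorm 0 α`). Under BDSV's hypothesis
`|t - t₀| ‖v‖₁ ≤ 1` the factor is `e^α ≤ e`; the printed constant `2` is immaterial in all uses
(`≲`).

## Proof

The velocity lifts to a smooth field on `[a,b] × ℝ^d`, bounded and `K`-Lipschitz in space, so
through every `(t, y)` there is a characteristic `γ` on `[a,b]` (Mathlib's Picard–Lindelöf
theorem `IsPicardLindelof.exists_eq_forall_mem_Icc_hasDerivWithinAt`), two characteristics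
through `(t, y₁)`, `(t, y₂)` satisfy `|γ₁(s) - γ₂(s)| ≤ |y₁ - y₂| e^{K|s-t|}` (Grönwall,
`dist_le_of_trajectories_ODE_of_mem`, applied forward and, after time reversal, backward), and
along characteristics `d/ds f(s, γ(s)) = g(s, γ(s))` (chain rule for the space–time lift within
`[a,b] × ℝ^d`). The mean value inequality then gives both estimates pointwise; no integral is
needed.

## References

* T. Buckmaster, C. De Lellis, L. Székelyhidi Jr., V. Vicol, *Onsager's conjecture for admissible
  weak solutions*, Comm. Pure Appl. Math. 72 (2019) 229–274 = arXiv:1701.08678, App. B,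
  Prop. B.1 (B.1)–(B.2).
* T. Buckmaster, C. De Lellis, P. Isett, L. Székelyhidi Jr., *Anomalous dissipation for
  `1/5`-Hölder Euler flows*, Ann. of Math. 182 (2015), App. (transport estimates).
-/

noncomputable section

open MeasureTheory Set Filter Metric Function
open scoped NNReal ENNReal ContDiff Topology

namespace Literature.Analysis.FluidPDE

namespace Torus

open FunctionSpaces FunctionSpaces.Torus

/-! ## Grönwall for two trajectories, forward and backward in time -/

section Trajectories

variable {E : Type*} [NormedAddCommGroup E] [NormedSpace ℝ E]

/-- Forward Grönwall bound for two trajectories with derivatives within `[a,b]`: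
for `t ≤ s` in `[a,b]`, `dist (γ₁ s) (γ₂ s) ≤ dist (γ₁ t) (γ₂ t) e^{K(s-t)}`. [folklore] -/
theorem dist_trajectories_le_forward {v : ℝ → E → E} {a b : ℝ} {K : ℝ≥0}
    (hv : ∀ s ∈ Icc a b, LipschitzWith K (v s)) {γ₁ γ₂ : ℝ → E}
    (h₁ : ∀ s ∈ Icc a b, HasDerivWithinAt γ₁ (v s (γ₁ s)) (Icc a b) s)
    (h₂ : ∀ s ∈ Icc a b, HasDerivWithinAt γ₂ (v s (γ₂ s)) (Icc a b) s)
    {t s : ℝ} (ht : t ∈ Icc a b) (hs : s ∈ Icc a b) (hts : t ≤ s) :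
    dist (γ₁ s) (γ₂ s) ≤ dist (γ₁ t) (γ₂ t) * Real.exp (K * (s - t)) := by
  have hsub : Icc t s ⊆ Icc a b := Icc_subset_Icc ht.1 hs.2
  have hc₁ : ContinuousOn γ₁ (Icc t s) := fun σ hσ => ((h₁ σ (hsub hσ)).continuousWithinAt).mono hsub
  have hc₂ : ContinuousOn γ₂ (Icc t s) := fun σ hσ => ((h₂ σ (hsub hσ)).continuousWithinAt).mono hsub
  have hnhds : ∀ σ ∈ Ico t s, Icc a b ∈ 𝓝[Ici σ] σ := fun σ hσ =>
    Icc_mem_nhdsGE_of_mem ⟨ht.1.trans hσ.1, hσ.2.trans_le hs.2⟩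
  have hd₁ : ∀ σ ∈ Ico t s, HasDerivWithinAt γ₁ (v σ (γ₁ σ)) (Ici σ) σ := fun σ hσ =>
    (h₁ σ (hsub (Ico_subset_Icc_self hσ))).mono_of_mem_nhdsWithin (hnhds σ hσ)
  have hd₂ : ∀ σ ∈ Ico t s, HasDerivWithinAt γ₂ (v σ (γ₂ σ)) (Ici σ) σ := fun σ hσ =>
    (h₂ σ (hsub (Ico_subset_Icc_self hσ))).mono_of_mem_nhdsWithin (hnhds σ hσ)
  have hlip : ∀ σ ∈ Ico t s, LipschitzOnWith K (v σ) univ := fun σ hσ =>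
    (hv σ (hsub (Ico_subset_Icc_self hσ))).lipschitzOnWith
  exact dist_le_of_trajectories_ODE_of_mem (s := fun _ => univ) hlip hc₁ hd₁
    (fun _ _ => mem_univ _) hc₂ hd₂ (fun _ _ => mem_univ _) le_rfl s (right_mem_Icc.2 hts)

/-- **Two-sided Grönwall bound for trajectories.** Two solutions of `γ' = v(s, γ)` on `[a,b]`
(derivatives within `[a,b]`), with `v(s, ·)` `K`-Lipschitz for `s ∈ [a,b]`, satisfy
`dist (γ₁ s) (γ₂ s) ≤ dist (γ₁ t) (γ₂ t) e^{K|s-t|}` for all `s, t ∈ [a,b]` (forward: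
`dist_le_of_trajectories_ODE_of_mem`; backward: the same for the time-reversed trajectories
`σ ↦ γᵢ(-σ)`, which solve `γ' = -v(-σ, γ)`). [folklore] -/
theorem dist_trajectories_le_two_sided {v : ℝ → E → E} {a b : ℝ} {K : ℝ≥0}
    (hv : ∀ s ∈ Icc a b, LipschitzWith K (v s)) {γ₁ γ₂ : ℝ → E}
    (h₁ : ∀ s ∈ Icc a b, HasDerivWithinAt γ₁ (v s (γ₁ s)) (Icc a b) s)
    (h₂ : ∀ s ∈ Icc a b, HasDerivWithinAt γ₂ (v s (γ₂ s)) (Icc a b) s)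
    {t s : ℝ} (ht : t ∈ Icc a b) (hs : s ∈ Icc a b) :
    dist (γ₁ s) (γ₂ s) ≤ dist (γ₁ t) (γ₂ t) * Real.exp (K * |s - t|) := by
  rcases le_or_gt t s with hts | hst
  · rw [abs_of_nonneg (sub_nonneg.2 hts)]
    exact dist_trajectories_le_forward hv h₁ h₂ ht hs hts
  · -- time reversal
    rw [abs_of_neg (sub_neg.2 hst), neg_sub]
    set w : ℝ → E → E := fun σ z => -v (-σ) z with hw
    set δ₁ : ℝ → E := fun σ => γ₁ (-σ) with hδ₁
    set δ₂ : ℝ → E := fun σ => γ₂ (-σ) with hδ₂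
    have hw' : ∀ σ ∈ Icc (-b) (-a), LipschitzWith K (w σ) := fun σ hσ =>
      (hv (-σ) ⟨by linarith [hσ.2], by linarith [hσ.1]⟩).neg
    have hrev : ∀ {γ : ℝ → E}, (∀ s ∈ Icc a b, HasDerivWithinAt γ (v s (γ s)) (Icc a b) s) →
        ∀ σ ∈ Icc (-b) (-a), HasDerivWithinAt (fun σ => γ (-σ)) (w σ (γ (-σ))) (Icc (-b) (-a)) σ := by
      intro γ hγ σ hσ
      have hmem : -σ ∈ Icc a b := ⟨by linarith [hσ.2], by linarith [hσ.1]⟩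
      have hneg : HasDerivWithinAt (fun σ : ℝ => -σ) (-1 : ℝ) (Icc (-b) (-a)) σ :=
        (hasDerivWithinAt_id σ _).neg
      have hmaps : MapsTo (fun σ : ℝ => -σ) (Icc (-b) (-a)) (Icc a b) := fun τ hτ =>
        ⟨by linarith [hτ.2], by linarith [hτ.1]⟩
      have h := (hγ (-σ) hmem).scomp σ hneg hmaps
      have heq : ((-1 : ℝ) • v (-σ) (γ (-σ))) = w σ (γ (-σ)) := by
        simp [hw]
      rw [heq] at h
      exact h
    have hd₁ := hrev h₁
    have hd₂ := hrev h₂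
    have hnt : -t ∈ Icc (-b) (-a) := ⟨by linarith [ht.2], by linarith [ht.1]⟩
    have hns : -s ∈ Icc (-b) (-a) := ⟨by linarith [hs.2], by linarith [hs.1]⟩
    have h := dist_trajectories_le_forward hw' hd₁ hd₂ hnt hns (by linarith)
    simp only [neg_neg] at h
    convert h using 2
    ring

end Trajectories

/-! ## The lifted velocity field and its characteristics -/

section Characteristics

variable {d : Type*} [Fintype d]

/-- The lift of a `C¹` slice with `‖Du‖ ≤ K` is `K`-Lipschitz on `ℝ^d` (mean value inequality).
[folklore] -/
theorem lipschitzWith_lift_of_norm_fderiv_le {w : UnitAddTorus d → EuclideanSpace ℝ d} (hw : IsContDiff 1 w)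
    {K : ℝ≥0} (hK : ∀ x, ‖Torus.fderiv w x‖ ≤ K) : LipschitzWith K (lift w) := by
  refine lipschitzWith_of_nnnorm_fderiv_le (hw.differentiable one_ne_zero) fun y => ?_
  rw [← NNReal.coe_le_coe, coe_nnnorm, fderiv_lift]
  exact hK _

variable {a b : ℝ} {u : ℝ → UnitAddTorus d → EuclideanSpace ℝ d}

/-- **Characteristics exist on the whole time interval.** For a velocity field jointly smooth
on `[a,b] × T^d` whose lift is `K`-Lipschitz in space, through every `(t, y)`, `t ∈ [a,b]`,
`y ∈ ℝ^d`, there is a solution `γ` of `γ'(s) = u(s, γ(s))` on `[a,b]` (derivatives within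
`[a,b]`) with `γ(t) = y` (Picard–Lindelöf on a ball of radius `sup |u| · (b - a)`). [folklore] -/
theorem exists_characteristic (hu : IsSmoothSpaceTimeOn (Icc a b) u) {K : ℝ≥0}
    (hK : ∀ s ∈ Icc a b, LipschitzWith K (lift (u s))) {t : ℝ} (ht : t ∈ Icc a b) (y : EuclideanSpace ℝ d) :
    ∃ γ : ℝ → EuclideanSpace ℝ d, γ t = y ∧
      ∀ s ∈ Icc a b, HasDerivWithinAt γ (lift (u s) (γ s)) (Icc a b) s := by
  -- a global bound for the velocity
  obtain ⟨M, hM⟩ := hu.exists_norm_le_of_isCompact isCompact_Icc subset_rfl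
  have hM0 : 0 ≤ M := (norm_nonneg _).trans (hM t ht (proj y))
  set L : ℝ≥0 := ⟨M, hM0⟩ with hL
  have hab : a ≤ b := ht.1.trans ht.2
  set R : ℝ≥0 := ⟨M * (b - a), mul_nonneg hM0 (sub_nonneg.2 hab)⟩ with hR
  have hPL : IsPicardLindelof (fun s z => lift (u s) z) (⟨t, ht⟩ : Icc a b) y R 0 L K := by
    refine ⟨fun s hs => (hK s hs).lipschitzOnWith, fun z _ => ?_, fun s hs z _ => ?_, ?_⟩
    · -- continuity in time of `s ↦ u s (proj z)`
      have hc := hu.continuousOn_stLift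
      have h2 : ContinuousOn (fun s : ℝ => ((s, z) : ℝ × EuclideanSpace ℝ d)) (Icc a b) :=
        (continuous_id.prodMk continuous_const).continuousOn
      exact hc.comp h2 fun s hs => mk_mem_prod hs (mem_univ _)
    · exact hM s hs (proj z)
    · rw [NNReal.coe_zero, sub_zero]
      change M * max (b - t) (t - a) ≤ M * (b - a)
      exact mul_le_mul_of_nonneg_left (max_le (by linarith [ht.1]) (by linarith [ht.2])) hM0
  exact hPL.exists_eq_forall_mem_Icc_hasDerivWithinAt₀

/-- **Derivative along characteristics.** If `f` is jointly smooth on `[a,b] × T^d`, `a < b`,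
and `γ` solves `γ' = u(s, γ)` within `[a,b]`, then
`d/ds f(s, γ(s)) = ∂ₜf(s, γ(s)) + D(f s)(γ(s)) · u(s, γ(s))` within `[a,b]` (chain rule for the
space–time lift). [folklore] -/
theorem hasDerivWithinAt_comp_characteristic {F : Type*} [NormedAddCommGroup F] [NormedSpace ℝ F]
    (hab : a < b) {f : ℝ → UnitAddTorus d → F} (hf : IsSmoothSpaceTimeOn (Icc a b) f)
    {γ : ℝ → EuclideanSpace ℝ d} {s : ℝ} (hs : s ∈ Icc a b)
    (hγ : HasDerivWithinAt γ (lift (u s) (γ s)) (Icc a b) s) :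
    HasDerivWithinAt (fun σ => f σ (proj (γ σ)))
      (timeDerivWithin (Icc a b) f s (proj (γ s)) + convect (u s) (f s) (proj (γ s)))
      (Icc a b) s := by
  have hU : UniqueDiffOn ℝ (Icc a b) := uniqueDiffOn_Icc hab
  have h1 : HasFDerivWithinAt (stLift f) (fderivWithin ℝ (stLift f) (Icc a b ×ˢ univ) (s, γ s))
      (Icc a b ×ˢ univ) (s, γ s) :=
    (hf.differentiableOn (by simp) (s, γ s) (mk_mem_prod hs (mem_univ _))).hasFDerivWithinAt
  have h2 : HasDerivWithinAt (fun σ : ℝ => ((σ, γ σ) : ℝ × EuclideanSpace ℝ d)) ((1 : ℝ), lift (u s) (γ s))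
      (Icc a b) s := (hasDerivWithinAt_id s _).prodMk hγ
  have h3 := h1.comp_hasDerivWithinAt s h2 fun σ hσ => mk_mem_prod hσ (mem_univ _)
  have hsplit : fderivWithin ℝ (stLift f) (Icc a b ×ˢ univ) (s, γ s) ((1 : ℝ), lift (u s) (γ s)) =
      fderivWithin ℝ (stLift f) (Icc a b ×ˢ univ) (s, γ s) ((1 : ℝ), (0 : EuclideanSpace ℝ d)) +
        fderivWithin ℝ (stLift f) (Icc a b ×ˢ univ) (s, γ s) ((0 : ℝ), lift (u s) (γ s)) := by
    rw [← map_add]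
    simp
  rw [hsplit, ← hf.timeDerivWithin_apply_proj hU hs, ← hf.fderiv_slice_apply hs] at h3
  exact h3

end Characteristics

/-! ## The transport estimates -/

section Transport

variable {d : Type*} [Fintype d] {F : Type*} [NormedAddCommGroup F] [NormedSpace ℝ F]

variable {a b : ℝ} {u : ℝ → UnitAddTorus d → EuclideanSpace ℝ d} {f g : ℝ → UnitAddTorus d → F}

/-- **Pointwise transport bound** (the method of characteristics behind BDSV (B.1)): for a
smooth solution of `∂ₜf + (u·∇)f = g` on `[a,b] × T^d` and a characteristic `γ` through
`(t, y)`, `‖f(t, y) - f(t₀, γ(t₀))‖ ≤ |t - t₀| · G` whenever `‖g(s, ·)‖ ≤ G` between `t₀` and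
`t`. [folklore] -/
theorem norm_sub_along_characteristic_le (hab : a < b) (hf : IsSmoothSpaceTimeOn (Icc a b) f)
    (heq : ∀ s ∈ Icc a b, ∀ x, timeDerivWithin (Icc a b) f s x + convect (u s) (f s) x = g s x)
    {t₀ t : ℝ} (ht₀ : t₀ ∈ Icc a b) (ht : t ∈ Icc a b) {γ : ℝ → EuclideanSpace ℝ d}
    (hγ : ∀ s ∈ Icc a b, HasDerivWithinAt γ (lift (u s) (γ s)) (Icc a b) s)
    {G : ℝ} (hG : ∀ s ∈ uIcc t₀ t, ∀ x, ‖g s x‖ ≤ G) :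
    ‖f t (proj (γ t)) - f t₀ (proj (γ t₀))‖ ≤ |t - t₀| * G := by
  have hsub : uIcc t₀ t ⊆ Icc a b := uIcc_subset_Icc ht₀ ht
  have hderiv : ∀ s ∈ uIcc t₀ t, HasDerivWithinAt (fun σ => f σ (proj (γ σ))) (g s (proj (γ s)))
      (uIcc t₀ t) s := by
    intro s hs
    have h := hasDerivWithinAt_comp_characteristic hab hf (hsub hs) (hγ s (hsub hs))
    rw [heq s (hsub hs)] at h
    exact h.mono hsub
  have h := Convex.norm_image_sub_le_of_norm_hasDerivWithin_le hderiv
    (fun s hs => hG s hs _) (convex_uIcc t₀ t) left_mem_uIcc right_mem_uIcc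
  rw [Real.norm_eq_abs] at h
  linarith [mul_comm G |t - t₀|]

/-- **`L^∞` transport estimate** (BDSV (B.1)): `‖f(t)‖_∞ ≤ ‖f(t₀)‖_∞ + |t - t₀| sup_s ‖g(s)‖_∞`,
the sup over `s` between `t₀` and `t`, for a smooth solution of `∂ₜf + (u·∇)f = g` on
`[a,b] × T^d`. [cite: BuckmasterEtAl2018, Prop. B.1 (B.1)] -/
theorem eSupNorm_transport_le (hab : a < b) (hu : IsSmoothSpaceTimeOn (Icc a b) u)
    (hf : IsSmoothSpaceTimeOn (Icc a b) f)
    (heq : ∀ s ∈ Icc a b, ∀ x, timeDerivWithin (Icc a b) f s x + convect (u s) (f s) x = g s x)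
    {K : ℝ≥0} (hK : ∀ s ∈ Icc a b, ∀ x, ‖Torus.fderiv (u s) x‖ ≤ K)
    {t₀ t : ℝ} (ht₀ : t₀ ∈ Icc a b) (ht : t ∈ Icc a b) :
    eSupNorm (f t) ≤ eSupNorm (f t₀) + ENNReal.ofReal |t - t₀| * ⨆ s ∈ uIcc t₀ t, eSupNorm (g s) := by
  set Sf := eSupNorm (f t₀) with hSf
  set Sg := ⨆ s ∈ uIcc t₀ t, eSupNorm (g s) with hSg
  by_cases hfT : Sf = ⊤
  · rw [hfT, top_add]; exact le_top
  rcases eq_or_ne t t₀ with rfl | htt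
  · exact le_self_add
  by_cases hgT : Sg = ⊤
  · have hpos : ENNReal.ofReal |t - t₀| ≠ 0 := by
      rw [Ne, ENNReal.ofReal_eq_zero, not_le, abs_pos]
      exact sub_ne_zero.2 htt
    rw [hgT, ENNReal.mul_top hpos, add_top]; exact le_top
  -- real bounds
  have hlip : ∀ s ∈ Icc a b, LipschitzWith K (lift (u s)) := fun s hs =>
    lipschitzWith_lift_of_norm_fderiv_le ((hu.isSmooth_slice hs).isContDiff (by simp)) (hK s hs)
  have hSf' : ∀ x, ‖f t₀ x‖ ≤ Sf.toReal := fun x => by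
    rw [← ENNReal.ofReal_le_iff_le_toReal hfT, ofReal_norm]
    exact enorm_le_eSupNorm _ x
  have hSg' : ∀ s ∈ uIcc t₀ t, ∀ x, ‖g s x‖ ≤ Sg.toReal := fun s hs x => by
    rw [← ENNReal.ofReal_le_iff_le_toReal hgT, ofReal_norm]
    exact (enorm_le_eSupNorm _ x).trans (le_iSup₂ (f := fun s _ => eSupNorm (g s)) s hs)
  refine iSup_le fun x => ?_
  obtain ⟨y, rfl⟩ := proj_surjective x
  obtain ⟨γ, hγt, hγ⟩ := exists_characteristic hu hlip ht y
  have h1 := norm_sub_along_characteristic_le hab hf heq ht₀ ht hγ hSg'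
  rw [hγt] at h1
  have h2 : ‖f t (proj y)‖ ≤ Sf.toReal + |t - t₀| * Sg.toReal :=
    calc ‖f t (proj y)‖ ≤ ‖f t₀ (proj (γ t₀))‖ + ‖f t (proj y) - f t₀ (proj (γ t₀))‖ :=
          norm_le_insert' _ _
      _ ≤ Sf.toReal + |t - t₀| * Sg.toReal := add_le_add (hSf' _) h1
  calc ‖f t (proj y)‖ₑ = ENNReal.ofReal ‖f t (proj y)‖ := (ofReal_norm _).symm
    _ ≤ ENNReal.ofReal (Sf.toReal + |t - t₀| * Sg.toReal) := ENNReal.ofReal_le_ofReal h2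
    _ = Sf + ENNReal.ofReal |t - t₀| * Sg := by
        rw [ENNReal.ofReal_add ENNReal.toReal_nonneg (by positivity),
          ENNReal.ofReal_mul (abs_nonneg _), ENNReal.ofReal_toReal hfT, ENNReal.ofReal_toReal hgT]

/-- **Pointwise Hölder transport bound** (the method of characteristics behind BDSV (B.2)): with
`‖Du‖ ≤ K` on `[a,b] × T^d`, if `f(t₀)` is `α`-Hölder with constant `H₀` and the `g(s)`, `s`
between `t₀` and `t`, are `α`-Hölder with constant `H` (on the lifts), then
`‖f(t, y₁) - f(t, y₂)‖ ≤ e^{αK|t-t₀|} (H₀ + |t - t₀| H) ‖y₁ - y₂‖^α`. [folklore] -/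
theorem norm_sub_transport_le (hab : a < b) (hu : IsSmoothSpaceTimeOn (Icc a b) u)
    (hf : IsSmoothSpaceTimeOn (Icc a b) f)
    (heq : ∀ s ∈ Icc a b, ∀ x, timeDerivWithin (Icc a b) f s x + convect (u s) (f s) x = g s x)
    {K : ℝ≥0} (hK : ∀ s ∈ Icc a b, ∀ x, ‖Torus.fderiv (u s) x‖ ≤ K)
    {t₀ t : ℝ} (ht₀ : t₀ ∈ Icc a b) (ht : t ∈ Icc a b) {α : ℝ≥0} {H₀ H : ℝ} (hH₀ : 0 ≤ H₀)
    (hH : 0 ≤ H)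
    (hf₀ : ∀ z₁ z₂ : EuclideanSpace ℝ d, ‖f t₀ (proj z₁) - f t₀ (proj z₂)‖ ≤ H₀ * ‖z₁ - z₂‖ ^ (α : ℝ))
    (hg : ∀ s ∈ uIcc t₀ t, ∀ z₁ z₂ : EuclideanSpace ℝ d, ‖g s (proj z₁) - g s (proj z₂)‖ ≤ H * ‖z₁ - z₂‖ ^ (α : ℝ))
    (y₁ y₂ : EuclideanSpace ℝ d) :
    ‖f t (proj y₁) - f t (proj y₂)‖ ≤
      Real.exp (α * K * |t - t₀|) * (H₀ + |t - t₀| * H) * ‖y₁ - y₂‖ ^ (α : ℝ) := by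
  have hα : (0 : ℝ) ≤ α := α.2
  have hsub : uIcc t₀ t ⊆ Icc a b := uIcc_subset_Icc ht₀ ht
  have hlip : ∀ s ∈ Icc a b, LipschitzWith K (lift (u s)) := fun s hs =>
    lipschitzWith_lift_of_norm_fderiv_le ((hu.isSmooth_slice hs).isContDiff (by simp)) (hK s hs)
  obtain ⟨γ₁, hγ₁t, hγ₁⟩ := exists_characteristic hu hlip ht y₁
  obtain ⟨γ₂, hγ₂t, hγ₂⟩ := exists_characteristic hu hlip ht y₂
  set D : ℝ := ‖y₁ - y₂‖ with hD
  set X : ℝ := Real.exp (α * K * |t - t₀|) with hX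
  -- distance of the characteristics between `t₀` and `t`
  have hdist : ∀ s ∈ uIcc t₀ t, ‖γ₁ s - γ₂ s‖ ^ (α : ℝ) ≤ X * D ^ (α : ℝ) := by
    intro s hs
    have h := dist_trajectories_le_two_sided hlip hγ₁ hγ₂ ht (hsub hs)
    rw [hγ₁t, hγ₂t, dist_eq_norm, dist_eq_norm] at h
    have hst : |s - t| ≤ |t - t₀| := by
      rw [abs_sub_comm s t]
      exact abs_sub_right_of_mem_uIcc hs
    calc ‖γ₁ s - γ₂ s‖ ^ (α : ℝ) ≤ (D * Real.exp (K * |s - t|)) ^ (α : ℝ) :=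
          Real.rpow_le_rpow (norm_nonneg _) h hα
      _ = D ^ (α : ℝ) * Real.exp (K * |s - t| * α) := by
          rw [Real.mul_rpow (norm_nonneg _) (Real.exp_pos _).le, ← Real.exp_mul]
      _ ≤ D ^ (α : ℝ) * X := by
          refine mul_le_mul_of_nonneg_left (Real.exp_le_exp.2 ?_) (Real.rpow_nonneg (norm_nonneg _) _)
          calc (K : ℝ) * |s - t| * α = α * K * |s - t| := by ring
            _ ≤ α * K * |t - t₀| := mul_le_mul_of_nonneg_left hst (mul_nonneg hα K.2)
      _ = X * D ^ (α : ℝ) := mul_comm _ _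
  -- the difference along the two characteristics
  set ψ : ℝ → F := fun σ => f σ (proj (γ₁ σ)) - f σ (proj (γ₂ σ)) with hψ
  have hderiv : ∀ s ∈ uIcc t₀ t,
      HasDerivWithinAt ψ (g s (proj (γ₁ s)) - g s (proj (γ₂ s))) (uIcc t₀ t) s := by
    intro s hs
    have h1 := hasDerivWithinAt_comp_characteristic hab hf (hsub hs) (hγ₁ s (hsub hs))
    have h2 := hasDerivWithinAt_comp_characteristic hab hf (hsub hs) (hγ₂ s (hsub hs))
    rw [heq s (hsub hs)] at h1 h2
    exact (h1.sub h2).mono hsub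
  have hbound : ∀ s ∈ uIcc t₀ t, ‖g s (proj (γ₁ s)) - g s (proj (γ₂ s))‖ ≤ H * (X * D ^ (α : ℝ)) :=
    fun s hs => (hg s hs _ _).trans (mul_le_mul_of_nonneg_left (hdist s hs) hH)
  have hMV := Convex.norm_image_sub_le_of_norm_hasDerivWithin_le hderiv hbound (convex_uIcc t₀ t)
    left_mem_uIcc right_mem_uIcc
  rw [Real.norm_eq_abs] at hMV
  have h0 : ‖ψ t₀‖ ≤ H₀ * (X * D ^ (α : ℝ)) :=
    (hf₀ (γ₁ t₀) (γ₂ t₀)).trans (mul_le_mul_of_nonneg_left (hdist t₀ left_mem_uIcc) hH₀)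
  have hψt : ψ t = f t (proj y₁) - f t (proj y₂) := by
    simp [hψ, hγ₁t, hγ₂t]
  calc ‖f t (proj y₁) - f t (proj y₂)‖ = ‖ψ t‖ := by rw [hψt]
    _ ≤ ‖ψ t₀‖ + ‖ψ t - ψ t₀‖ := norm_le_insert' _ _
    _ ≤ H₀ * (X * D ^ (α : ℝ)) + H * (X * D ^ (α : ℝ)) * |t - t₀| := add_le_add h0 hMV
    _ = X * (H₀ + |t - t₀| * H) * D ^ (α : ℝ) := by ring

omit [NormedSpace ℝ F] in
/-- Real form of the Hölder seminorm bound: `[φ]_α ≤ H` gives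
`‖φ z₁ - φ z₂‖ ≤ H ‖z₁ - z₂‖^α`. [folklore] -/
theorem norm_sub_le_of_eHolderNorm_le {E' : Type*} [NormedAddCommGroup E'] {φ : E' → F} {α : ℝ≥0}
    {H : ℝ} (hH : 0 ≤ H) (h : eHolderNorm α φ ≤ ENNReal.ofReal H) (z₁ z₂ : E') :
    ‖φ z₁ - φ z₂‖ ≤ H * ‖z₁ - z₂‖ ^ (α : ℝ) := by
  have h1 := edist_le_eHolderNorm_mul_rpow α φ z₁ z₂
  rw [edist_eq_enorm_sub, edist_eq_enorm_sub, ← ofReal_norm, ← ofReal_norm,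
    ENNReal.ofReal_rpow_of_nonneg (norm_nonneg _) (NNReal.coe_nonneg α)] at h1
  have h2 : ENNReal.ofReal ‖φ z₁ - φ z₂‖ ≤ ENNReal.ofReal (H * ‖z₁ - z₂‖ ^ (α : ℝ)) := by
    rw [ENNReal.ofReal_mul hH]
    exact h1.trans (mul_le_mul' h le_rfl)
  exact (ENNReal.ofReal_le_ofReal_iff (by positivity)).1 h2

omit [NormedSpace ℝ F] in
/-- Extended form of a real Hölder bound: `‖φ z₁ - φ z₂‖ ≤ H ‖z₁ - z₂‖^α` for all `z₁, z₂`
gives `[φ]_α ≤ H`. [folklore] -/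
theorem eHolderNorm_le_ofReal_of_norm_sub_le {E' : Type*} [NormedAddCommGroup E'] {φ : E' → F}
    {α : ℝ≥0} {H : ℝ} (hH : 0 ≤ H) (h : ∀ z₁ z₂, ‖φ z₁ - φ z₂‖ ≤ H * ‖z₁ - z₂‖ ^ (α : ℝ)) :
    eHolderNorm α φ ≤ ENNReal.ofReal H := by
  refine eHolderNorm_le_of_forall_edist_le fun z₁ z₂ => ?_
  rw [edist_eq_enorm_sub, edist_eq_enorm_sub, ← ofReal_norm, ← ofReal_norm,
    ENNReal.ofReal_rpow_of_nonneg (norm_nonneg _) (NNReal.coe_nonneg α), ← ENNReal.ofReal_mul hH]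
  exact ENNReal.ofReal_le_ofReal (h z₁ z₂)

/-- **Hölder transport estimate** (BDSV (B.2), sharp form): for a smooth solution of
`∂ₜf + (u·∇)f = g` on `[a,b] × T^d` with `‖Du‖ ≤ K`,
`[f(t)]_α ≤ e^{αK|t-t₀|} ([f(t₀)]_α + |t - t₀| sup_s [g(s)]_α)`, Hölder seminorms of the
periodic lifts, the sup over `s` between `t₀` and `t` (for `|t - t₀| K ≤ 1` the factor is at
most `e`; BDSV print the constant `2`). [cite: BuckmasterEtAl2018, Prop. B.1 (B.2)] -/
theorem eHolderNorm_transport_le (hab : a < b) (hu : IsSmoothSpaceTimeOn (Icc a b) u)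
    (hf : IsSmoothSpaceTimeOn (Icc a b) f)
    (heq : ∀ s ∈ Icc a b, ∀ x, timeDerivWithin (Icc a b) f s x + convect (u s) (f s) x = g s x)
    {K : ℝ≥0} (hK : ∀ s ∈ Icc a b, ∀ x, ‖Torus.fderiv (u s) x‖ ≤ K)
    {t₀ t : ℝ} (ht₀ : t₀ ∈ Icc a b) (ht : t ∈ Icc a b) (α : ℝ≥0) :
    eHolderNorm α (lift (f t)) ≤ ENNReal.ofReal (Real.exp (α * K * |t - t₀|)) *
      (eHolderNorm α (lift (f t₀)) +
        ENNReal.ofReal |t - t₀| * ⨆ s ∈ uIcc t₀ t, eHolderNorm α (lift (g s))) := by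
  set Hf := eHolderNorm α (lift (f t₀)) with hHf
  set Hg := ⨆ s ∈ uIcc t₀ t, eHolderNorm α (lift (g s)) with hHg
  set X : ℝ := Real.exp (α * K * |t - t₀|) with hX
  have hX0 : 0 < X := Real.exp_pos _
  have hXne : ENNReal.ofReal X ≠ 0 := by
    rw [Ne, ENNReal.ofReal_eq_zero, not_le]
    exact hX0
  by_cases hfT : Hf = ⊤
  · rw [hfT, top_add, ENNReal.mul_top hXne]
    exact le_top
  rcases eq_or_ne t t₀ with rfl | htt
  · have h1 : X = 1 := by
      rw [hX, sub_self, abs_zero, mul_zero, Real.exp_zero]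
    rw [h1, ENNReal.ofReal_one, one_mul, sub_self, abs_zero, ENNReal.ofReal_zero, zero_mul,
      add_zero]
  by_cases hgT : Hg = ⊤
  · have hpos : ENNReal.ofReal |t - t₀| ≠ 0 := by
      rw [Ne, ENNReal.ofReal_eq_zero, not_le, abs_pos]
      exact sub_ne_zero.2 htt
    rw [hgT, ENNReal.mul_top hpos, add_top, ENNReal.mul_top hXne]
    exact le_top
  -- real bounds
  have hf₀ : ∀ z₁ z₂ : EuclideanSpace ℝ d, ‖f t₀ (proj z₁) - f t₀ (proj z₂)‖ ≤ Hf.toReal * ‖z₁ - z₂‖ ^ (α : ℝ) :=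
    fun z₁ z₂ => norm_sub_le_of_eHolderNorm_le (φ := lift (f t₀)) ENNReal.toReal_nonneg
      (by rw [ENNReal.ofReal_toReal hfT]) z₁ z₂
  have hg' : ∀ s ∈ uIcc t₀ t, ∀ z₁ z₂ : EuclideanSpace ℝ d,
      ‖g s (proj z₁) - g s (proj z₂)‖ ≤ Hg.toReal * ‖z₁ - z₂‖ ^ (α : ℝ) :=
    fun s hs z₁ z₂ => norm_sub_le_of_eHolderNorm_le (φ := lift (g s)) ENNReal.toReal_nonneg
      (by
        rw [ENNReal.ofReal_toReal hgT]
        exact le_iSup₂ (f := fun s _ => eHolderNorm α (lift (g s))) s hs) z₁ z₂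
  have hpt := norm_sub_transport_le hab hu hf heq hK ht₀ ht ENNReal.toReal_nonneg
    ENNReal.toReal_nonneg hf₀ hg'
  have hC : 0 ≤ X * (Hf.toReal + |t - t₀| * Hg.toReal) := by positivity
  refine (eHolderNorm_le_ofReal_of_norm_sub_le (φ := lift (f t)) hC hpt).trans (le_of_eq ?_)
  rw [ENNReal.ofReal_mul hX0.le, ENNReal.ofReal_add ENNReal.toReal_nonneg (by positivity),
    ENNReal.ofReal_mul (abs_nonneg _), ENNReal.ofReal_toReal hfT, ENNReal.ofReal_toReal hgT]

/-- **Transport estimate in `C^{0,α}(T^d)`** (BDSV Prop. B.1 (B.1)–(B.2) combined, in the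
accepted norm `Torus.eContDiffHolderNorm 0 α = ‖·‖_∞ + [·]_α` of the lift): for a smooth solution
of `∂ₜf + (u·∇)f = g` on `[a,b] × T^d` with `‖Du‖ ≤ K`, if `‖f(t₀)‖_{0,α} ≤ A` and
`‖g(s)‖_{0,α} ≤ G` for `s` between `t₀` and `t`, then
`‖f(t)‖_{0,α} ≤ e^{αK|t-t₀|} (A + 2|t - t₀| G)`. [cite: BuckmasterEtAl2018, Prop. B.1] -/
theorem eContDiffHolderNorm_transport_le (hab : a < b) (hu : IsSmoothSpaceTimeOn (Icc a b) u)
    (hf : IsSmoothSpaceTimeOn (Icc a b) f)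
    (heq : ∀ s ∈ Icc a b, ∀ x, timeDerivWithin (Icc a b) f s x + convect (u s) (f s) x = g s x)
    {K : ℝ≥0} (hK : ∀ s ∈ Icc a b, ∀ x, ‖Torus.fderiv (u s) x‖ ≤ K)
    {t₀ t : ℝ} (ht₀ : t₀ ∈ Icc a b) (ht : t ∈ Icc a b) {α : ℝ≥0} {A G : ℝ} (hA : 0 ≤ A)
    (hG : 0 ≤ G) (hfA : Torus.eContDiffHolderNorm 0 α (f t₀) ≤ ENNReal.ofReal A)
    (hgG : ∀ s ∈ uIcc t₀ t, Torus.eContDiffHolderNorm 0 α (g s) ≤ ENNReal.ofReal G) :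
    Torus.eContDiffHolderNorm 0 α (f t) ≤
      ENNReal.ofReal (Real.exp (α * K * |t - t₀|) * (A + 2 * |t - t₀| * G)) := by
  set X : ℝ := Real.exp (α * K * |t - t₀|) with hX
  have hX1 : 1 ≤ X := Real.one_le_exp (by positivity)
  have hsplit : ∀ (φ : UnitAddTorus d → F), Torus.eContDiffHolderNorm 0 α φ =
      eSupNorm φ + eHolderNorm α (lift φ) := fun φ => by
    rw [Torus.eContDiffHolderNorm, eContDiffHolderNorm_zero_eq, eSupNorm_lift]
  have hSg : (⨆ s ∈ uIcc t₀ t, eSupNorm (g s)) ≤ ENNReal.ofReal G :=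
    iSup₂_le fun s hs => le_trans (by rw [hsplit]; exact le_self_add) (hgG s hs)
  have hHg : (⨆ s ∈ uIcc t₀ t, eHolderNorm α (lift (g s))) ≤ ENNReal.ofReal G :=
    iSup₂_le fun s hs => le_trans (by rw [hsplit]; exact le_add_self) (hgG s hs)
  have h1 := eSupNorm_transport_le hab hu hf heq hK ht₀ ht
  have h2 := eHolderNorm_transport_le hab hu hf heq hK ht₀ ht α
  have hX1' : (1 : ℝ≥0∞) ≤ ENNReal.ofReal X := by
    rw [← ENNReal.ofReal_one]
    exact ENNReal.ofReal_le_ofReal hX1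
  set cX := ENNReal.ofReal X with hcX
  set cT := ENNReal.ofReal |t - t₀| with hcT
  set cG := ENNReal.ofReal G with hcG
  rw [hsplit]
  calc eSupNorm (f t) + eHolderNorm α (lift (f t))
      ≤ (eSupNorm (f t₀) + cT * cG) + cX * (eHolderNorm α (lift (f t₀)) + cT * cG) := by
        refine add_le_add (h1.trans ?_) (h2.trans ?_)
        · exact add_le_add le_rfl (mul_le_mul' le_rfl hSg)
        · exact mul_le_mul' le_rfl (add_le_add le_rfl (mul_le_mul' le_rfl hHg))
    _ ≤ cX * (eSupNorm (f t₀) + cT * cG) + cX * (eHolderNorm α (lift (f t₀)) + cT * cG) :=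
        add_le_add (le_mul_of_one_le_left' hX1') le_rfl
    _ = cX * (eSupNorm (f t₀) + eHolderNorm α (lift (f t₀))) + 2 * cX * cT * cG := by ring
    _ ≤ cX * ENNReal.ofReal A + 2 * cX * cT * cG := by
        rw [← hsplit]
        exact add_le_add (mul_le_mul' le_rfl hfA) le_rfl
    _ = ENNReal.ofReal (X * (A + 2 * |t - t₀| * G)) := by
        rw [hcX, hcT, hcG, ← ENNReal.ofReal_ofNat 2, ← ENNReal.ofReal_mul (zero_le_one.trans hX1),
          ← ENNReal.ofReal_mul (by norm_num), ← ENNReal.ofReal_mul (by positivity),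
          ← ENNReal.ofReal_mul (by positivity), ← ENNReal.ofReal_add (by positivity) (by positivity)]
        congr 1
        ring

end Transport

end Torus

end Literature.Analysis.FluidPDE
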